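import Summits.AtomisticToContinuum.HydrodynamicLimit.Theses.BryanRoughSphereDial
import Literature.MathematicalPhysics.KineticTheory.RoughSphereFlowInline
import Literature.MathematicalPhysics.KineticTheory.LandauTellerEuler

/-!
# Birth skeleton for the crux `SmallKappaAccuracy` (stmt-AtomisticToContinuum-17359)

Route `BryanRoughSphereDial` (sub-problem `HydrodynamicLimit`), crux rank 6, the ENDPOINT RUNG of
Bryan's rough-sphere `κ`-dial: along `κ_N = r (N+1)^{-1/3}`, from rough local Gibbs data (thermal
spins at `θ₀`), for `r < r₀(δ, η)` and `N ≥ N₀(r)` the `χ`-tested empirical density / momentum /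
TRANSLATIONAL-energy fields of the deterministic rough flow `R^{κ_N}_t` are `δ`-close, outside an
event of `P_N ⊗ γ`-measure `≤ η`, to those of the CONJUNCT's packing-guarded classical hard-sphere
Euler solution — `∃ η₀` outermost, guard `ρ_t(x)σ³ < η₀`, verbatim the re-typed Statement's frame.
With `KappaSwapGap` it is the deciding theorem's second hypothesis
(`closes : KappaSwapGap → SmallKappaAccuracy → _root_.HydrodynamicLimit`).

## The line `birth` — the route's own two-layer plan for this node, typed

Route header, TWO-LAYER PLAN: "SmallKappaAccuracy ⇐ LandauTellerWindow (all r ∈ (0,r₁)) →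
RelaxationContinuity (classical Euler–Landau–Teller solutions with well-prepared data
θ_rot = θ_tr depend continuously on r at r = 0 on [0,t], ChenLevermoreLiu1994 structure; PDE,
provable with a local well-posedness theory) → SmallKappaAccuracy". Both notions it needs have
since LANDED in the Literature (grounder g70-10 on this item, 2026-08-16): the two-temperature
Euler–Landau–Teller solution class `IsLandauTellerEulerSolution σ r c T ρ u θ_tr θ_rot`
(`LandauTellerEuler.lean`, rate function `c` a PARAMETER, exchange `(3/2)ρ·(r c)·(θ_tr − θ_rot)`,
`r = 0` ⇒ `IsHardSphereEulerSolution`) and the named rough-sphere flow `roughFlow / roughInit /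
spinLaw` with the rewrite bridge from the items' inline `let` telescope
(`RoughSphereFlowInline.lean`: `roughFlow_inline`, `roughInit_inline`, `spinLaw_inline`).
So the crux is cut at the WINDOW PARAMETER `r`:

* `stub_landauTellerWindow` (S1, THE LEVER, open-problem): THE TWO-TEMPERATURE WINDOW, accuracy-free
  LLN form. There are a packing threshold `η₁`, a window `r₁ > 0` and ONE rate function `c`
  (smooth in the state on the open orthant at every `σ > 0` — `RateSmooth`; physically
  `c ∝ ρσ²Y(ρσ³)√θ_tr`, the `κ → 0` limit of `κ⁻¹ ×` the Pidduck/Widom/Condiff–Lu–Dahler exchange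
  frequency, NOT baked in: the prover names it) such that for continuous positive profiles,
  `σ < σ₀(profiles)`, EVERY `r ∈ (0, r₁)`, every classical Euler–Landau–Teller solution with
  parameter `r` on `[0,T)` in the band `ρσ³ < η₁` whose data are WELL PREPARED (`θ_rot(0,·) =
  θ_tr(0,·)`: the rough local Gibbs state carries thermal spins at the translational temperature)
  and match the local Gibbs laws at `t = 0` (`TendstoHydroFieldsAt … 0`, the conjunct's hypothesis,
  verbatim), the tested empirical density / momentum / translational-energy fields of
  `roughFlow (r (N+1)^{-1/3}) σ N (roughInit θ₀ p) t` converge IN PROBABILITY under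
  `P_N ⊗ spinLaw N` to `(ρ, ρu, ρ(|u|²/2 + 3θ_tr/2))(t)` at every `t < T`. (Fixed `r`, then
  `N → ∞`: the Euler–Landau–Teller window with `O(r)` spin dice per particle per unit time — the
  route's informal `LandauTellerWindow`, stmt-9558, in the form the endpoint consumes; the
  rotational-energy clause of 9558 is not load-bearing here and is left out.)
* `stub_relaxationContinuity` (S2, PDE, deterministic, no particles; L/XL in Lean, textbook on
  paper): CONTINUOUS DEPENDENCE AT `r = 0`. There is an EOS band `η₂ > 0` (inside the analytic
  low-density branch of `hsPressure`, `JaynesSqueeze.HsEosLowDensity_holds`) such that for every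
  admissible rate function `c`, every `σ > 0`, every guard `η_g ≤ η₂`, every classical hard-sphere
  Euler solution on `[0,T)` with `ρσ³ < η_g`, every `t < T`, continuous `χ` and `δ > 0` there is
  `r₀ > 0` such that for each `r ∈ (0,r₀)` SOME classical Euler–Landau–Teller solution with
  parameter `r` exists on a horizon `[0,T') ∋ t`, stays in the band `ρσ³ < η_g`, has the
  well-prepared data `(ρ, u, θ, θ)(0)` of the given solution, and at time `t` its `χ`-tested
  density / momentum / energy integrals are within `δ` of the given solution's. (Kato / Majda
  perturbation theory for the symmetrizable hyperbolic relaxation system — `HsEntropyConvex`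
  gives the convex entropy in the band — around the `r = 0` solution `(ρ, u, θ, θ_rot transported)`,
  `IsLandauTellerEulerSolution.rotTemperature_transport`; `C⁰([0,t] × 𝕋³)`-closeness implies the
  tested form.)

`SmallKappaAccuracy_of` (sorry-free): `η₀ := min η₁ η₂`; `σ₀ :=` S1's; given the guarded
hs-Euler solution, `t, χ, δ, η`: S2 at `(δ/2)` gives `r₀`; take `min r₀ r₁`; for `r` below it S2
hands an Euler–Landau–Teller solution `(ρ', u', θ', θr')` through the same data, S1 (at `δ/2`,
with the `t = 0` hypothesis transported along `ρ' 0 = ρ 0, u' 0 = u 0, θ' 0 = θ 0`) gives the three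
convergences in probability towards its fields, `ENNReal.tendsto_nhds_zero` extracts `N₀`, and the
triangle inequality `{δ < |F − I|} ⊆ {δ/2 < |F − I'|}` (`|I' − I| ≤ δ/2`) closes each clause by
`measure_mono`. The inline `let` telescope of the crux is turned into library language by
`rw [roughFlow_inline, roughInit_inline, spinLaw_inline]` (RoughSphereFlowInline, "How a prover
uses it") before any binder is introduced.

Disproof used: none relevant — `ledger crux ls stmt-AtomisticToContinuum-17359`: no workfiles
(no `Disproof.lean`, no `Negative/` lemma, no `_false_without_` theorem, no dead line) at
registration; negatives index (20 entries, 2026-08-17) has no rough-sphere / Landau–Teller /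
relaxation statement.
-/

noncomputable section

namespace Summit.AtomisticToContinuum.HydrodynamicLimit.Cruxes.SmallKappaAccuracy.Birth

open scoped BigOperators Topology ENNReal ContDiff
open Filter Set MeasureTheory
open Literature.MathematicalPhysics.KineticTheory Literature.Analysis.FluidPDE
open Summit.AtomisticToContinuum.HydrodynamicLimit.Theses.BryanRoughSphereDial

/-! ## Types and the two small notions the stubs share -/

/-- Phase space of `N + 1` spheres on `𝕋³` (the crux's `Cfg`). -/
abbrev Cfg (N : ℕ) : Type := Config (N + 1) (Fin 3) T3

/-- Normalised spins of `N + 1` spheres (the crux's `Spin`). -/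
abbrev Spin (N : ℕ) : Type := Fin (N + 1) → V3

/-- Families of hard-sphere flows at reduced diameter `σ` (the conjunct's `Φ`). -/
abbrev Flows (σ : ℝ) : Type :=
  (N : ℕ) → HardSphereFlow (Torus.geometry (Fin 3)) (hsDiameter σ N) (N + 1)

/-- The open positive orthant of the thermodynamic state `(ρ, θ_tr, θ_rot)`. -/
def PosOrthant : Set (ℝ × ℝ × ℝ) :=
  {p | 0 < p.1 ∧ 0 < p.2.1 ∧ 0 < p.2.2}

/-- ADMISSIBLE RATE FUNCTIONS `c : (σ, ρ, θ_tr, θ_rot) ↦ c` of the Landau–Teller exchange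
`(3/2) ρ (r c) (θ_tr − θ_rot)` (`landauTellerExchange`): at every `σ > 0`, smooth in the state on the
open orthant (the physical rate `∝ ρ σ² Y(ρσ³) √θ_tr` is, on the dilute branch; outside the band
the window stub may modify it at will). The class the PDE stub quantifies over and the window stub
lands in. -/
def RateSmooth (c : ℝ → ℝ → ℝ → ℝ → ℝ) : Prop :=
  ∀ σ : ℝ, 0 < σ → ContDiffOn ℝ ∞ (fun p : ℝ × ℝ × ℝ => c σ p.1 p.2.1 p.2.2) PosOrthant

/-! ## The two registered stubs -/

/-- **S1 — THE EULER–LANDAU–TELLER WINDOW (law of large numbers at fixed window parameter `r`;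
THE LEVER; open-problem).** There are a packing threshold `η₁ > 0`, a window `r₁ > 0` and an
admissible rate function `c` such that: for all continuous profiles `a₀, θ₀ > 0`, `u₀` there is
`σ₀ > 0` such that for `0 < σ < σ₀`, every `r ∈ (0, r₁)`, every classical two-temperature
Euler–Landau–Teller solution `(ρ, u, θ, θr)` with parameter `r` and rate `c` on `[0, T)`
(`IsLandauTellerEulerSolution σ r c T ρ u θ θr`) in the band `ρσ³ < η₁`, WELL PREPARED
(`θr(0,·) = θ(0,·)`), and every family of hard-sphere flows `Φ` whose local Gibbs laws
`P_N = localGibbsLaw σ a₀ u₀ θ₀ N (Φ N)` have empirical fields converging at `t = 0` to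
`(ρ, ρu, E)(0)`: at every `t < T`, for every continuous `χ` and `δ > 0`, under `P_N ⊗ spinLaw N` the
probability that the `χ`-tested empirical density (resp. momentum, translational kinetic energy)
field of the rough flow `roughFlow (r (N+1)^{-1/3}) σ N (roughInit θ₀ p) t` deviates by more than
`δ` from `∫χρ_t` (resp. `∫χρ_t u_t`, `∫χ ρ_t(|u_t|²/2 + 3θ_t/2)`) tends to `0` as `N → ∞`.
Why plausibly true: along `κ_N = r(N+1)^{-1/3}` the Bryan rule kicks each velocity with variance
`≍ r` per unit time and exchanges translational/rotational energy at rate `≍ r(θ − θr)` per particle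
(mean energy change `4κ(1+κ)⁻²(θr − θ)` per collision at thermal spins, `≍ σ²(N+1)^{1/3}`
collisions per unit time), momentum is pairwise exact and the normal impulse — hence `hsPressure` —
is the smooth spheres'; so the formal hydrodynamics IS the two-temperature system with a
Landau–Teller source linear in `r` (ChapmanCowling1970 §11.2–11.4 + Note B; Widom1960;
CondiffLuDahler1965; HuthmannZippelius1997 (16)–(17)), and the window keeps `O(r)` conservative
spin dice per particle per unit time as ergodic input. Why it might fail: the dice are sub-OVY
(bounded intensity, zero microscopic rate): neither FFL/LO nor OVY's Dirichlet-form step applies as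
printed, so local equilibrium of the TRANSLATIONAL marginal must still come largely from the
deterministic collisions (MacroErgodicityBarrier; BoltzmannHypothesisBarrier: nothing evaded
below the window); quadratic-KE cubic current tails (HighMomentumCutoffBarrier); ring-correlated
partner spins at positive `ρσ³` could bias the exchange law away from ANY local `c`.
Sources: OllaVaradhanYau1993 §2.1, §4; ChapmanCowling1970 Ch. 11; Widom1960; CondiffLuDahler1965;
HuthmannZippelius1997; ChenLevermoreLiu1994 §1; Spohn1991 Part I Ch. 3. -/
theorem stub_landauTellerWindow :
    ∃ η₁ : ℝ, 0 < η₁ ∧ ∃ r₁ : ℝ, 0 < r₁ ∧ ∃ c : ℝ → ℝ → ℝ → ℝ → ℝ, RateSmooth c ∧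
      ∀ (a₀ θ₀ : T3 → ℝ) (u₀ : T3 → V3), Continuous a₀ → Continuous θ₀ → Continuous u₀ →
        (∀ x, 0 < a₀ x) → (∀ x, 0 < θ₀ x) →
        ∃ σ₀ : ℝ, 0 < σ₀ ∧ ∀ σ : ℝ, 0 < σ → σ < σ₀ → ∀ r : ℝ, 0 < r → r < r₁ →
          ∀ (T : ℝ) (ρ θ θr : ℝ → T3 → ℝ) (u : ℝ → T3 → V3),
            IsLandauTellerEulerSolution σ r c T ρ u θ θr →
            (∀ s ∈ Set.Ico 0 T, ∀ x, ρ s x * σ ^ 3 < η₁) →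
            (∀ x, θr 0 x = θ 0 x) →
            ∀ Φ : Flows σ,
              TendstoHydroFieldsAt (fun N => localGibbsLaw σ a₀ u₀ θ₀ N (Φ N)) Φ ρ u θ 0 →
              ∀ t ∈ Set.Ico 0 T, ∀ χ : T3 → ℝ, Continuous χ → ∀ δ : ℝ, 0 < δ →
                Tendsto (fun N : ℕ => ((localGibbsLaw σ a₀ u₀ θ₀ N (Φ N)).prod (spinLaw N))
                    {p | δ < |empiricalDensityField
                      (roughFlow (r * ((N : ℝ) + 1) ^ (-(1 / 3 : ℝ))) σ N (roughInit θ₀ p) t).1 χ -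
                        ∫ x, χ x * ρ t x|}) atTop (𝓝 0) ∧
                Tendsto (fun N : ℕ => ((localGibbsLaw σ a₀ u₀ θ₀ N (Φ N)).prod (spinLaw N))
                    {p | δ < ‖empiricalMomentumField
                      (roughFlow (r * ((N : ℝ) + 1) ^ (-(1 / 3 : ℝ))) σ N (roughInit θ₀ p) t).1 χ -
                        ∫ x, (χ x * ρ t x) • u t x‖}) atTop (𝓝 0) ∧
                Tendsto (fun N : ℕ => ((localGibbsLaw σ a₀ u₀ θ₀ N (Φ N)).prod (spinLaw N))
                    {p | δ < |empiricalEnergyField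
                      (roughFlow (r * ((N : ℝ) + 1) ^ (-(1 / 3 : ℝ))) σ N (roughInit θ₀ p) t).1 χ -
                        ∫ x, χ x * totalEnergyDensity (ρ t x) (u t x) (θ t x)|})
                  atTop (𝓝 0) := by
  sorry

/-- **S2 — CONTINUOUS DEPENDENCE OF CLASSICAL EULER–LANDAU–TELLER SOLUTIONS ON THE WINDOW
PARAMETER AT `r = 0` (deterministic PDE, no particles; size L/XL in Lean, textbook on paper).**
There is an EOS band `η₂ > 0` such that for every admissible rate function `c`, every `σ > 0`, every
guard `0 < η_g ≤ η₂`, every classical hard-sphere Euler solution `(ρ, u, θ)` on `[0, T)` with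
`ρσ³ < η_g` on `[0,T) × 𝕋³`, every `t < T`, every continuous `χ` and `δ > 0`, there is `r₀ > 0` such
that for each `r ∈ (0, r₀)` SOME classical two-temperature solution `(ρ', u', θ', θr')` with
parameter `r` and rate `c` exists on a horizon `[0, T')` with `t < T'`, stays in the band
`ρ'σ³ < η_g`, has the WELL-PREPARED data of the given solution (`ρ' = ρ`, `u' = u`, `θ' = θ`,
`θr' = θ` at time `0`), and at time `t` its `χ`-tested density / momentum / total translational
energy integrals are within `δ` of the given solution's.
Why plausibly true (the standard perturbation theorem): inside the analytic low-density branch of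
the virial equation of state (`Theses.JaynesSqueeze.HsEosLowDensity_holds`, PROVED: `hsPressure` is
real-analytic in `(ρ, θ)` for `ρσ³ < η₂`) the two-temperature system is a symmetrizable hyperbolic
system of balance laws with a smooth zero-order source (`HsEntropyConvex`, 9906, proved, gives the
convex entropy of the Euler part; `θr` is advected); its `r = 0` member through the data
`(ρ, u, θ, θ)(0)` is the GIVEN solution with `θr` transported
(`IsLandauTellerEulerSolution.rotTemperature_transport`, `.isHardSphereEulerSolution`), classical on
`[0,T) ⊇ [0,t]`; Kato's local well-posedness and continuous dependence for quasilinear symmetric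
hyperbolic systems (smooth data on the compact `𝕋³`, coefficients smooth on a compact part of the
open orthant where `c σ` is `C^∞`) give, for `r` small, a smooth solution on `[0, t + ε]`
converging to the `r = 0` one in `C⁰([0,t+ε] × 𝕋³)` — hence positivity, the strict band (the given
solution's `max ρσ³` over the compact `[0,t+ε] × 𝕋³` is `< η_g`) and the tested closeness.
Why it might fail: only through the EOS — the band `η₂` must sit inside the analyticity radius of
`hsExcessFreeEnergy` (that is why it is existential here); no obstruction on the PDE side (the
classical solution class is `C^∞`, so no derivative loss bites). Sources: Kato1975 (ARMA 58),
Majda1984 Ch. 2 Thm 2.1–2.2, Dafermos2016 §5.1, ChenLevermoreLiu1994 §1, LebowitzPenrose1964,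
Ruelle1969 §3.4 / Thm 4.3.1. -/
theorem stub_relaxationContinuity :
    ∃ η₂ : ℝ, 0 < η₂ ∧ ∀ c : ℝ → ℝ → ℝ → ℝ → ℝ, RateSmooth c → ∀ σ : ℝ, 0 < σ →
      ∀ ηg : ℝ, 0 < ηg → ηg ≤ η₂ →
      ∀ (T : ℝ) (ρ θ : ℝ → T3 → ℝ) (u : ℝ → T3 → V3), IsHardSphereEulerSolution σ T ρ u θ →
        (∀ s ∈ Set.Ico 0 T, ∀ x, ρ s x * σ ^ 3 < ηg) →
        ∀ t ∈ Set.Ico 0 T, ∀ χ : T3 → ℝ, Continuous χ → ∀ δ : ℝ, 0 < δ →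
          ∃ r₀ : ℝ, 0 < r₀ ∧ ∀ r : ℝ, 0 < r → r < r₀ →
            ∃ (T' : ℝ) (ρ' θ' θr' : ℝ → T3 → ℝ) (u' : ℝ → T3 → V3),
              t < T' ∧ IsLandauTellerEulerSolution σ r c T' ρ' u' θ' θr' ∧
              (∀ s ∈ Set.Ico 0 T', ∀ x, ρ' s x * σ ^ 3 < ηg) ∧
              (∀ x, ρ' 0 x = ρ 0 x) ∧ (∀ x, u' 0 x = u 0 x) ∧ (∀ x, θ' 0 x = θ 0 x) ∧
              (∀ x, θr' 0 x = θ 0 x) ∧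
              |(∫ x, χ x * ρ' t x) - ∫ x, χ x * ρ t x| ≤ δ ∧
              ‖(∫ x, (χ x * ρ' t x) • u' t x) - ∫ x, (χ x * ρ t x) • u t x‖ ≤ δ ∧
              |(∫ x, χ x * totalEnergyDensity (ρ' t x) (u' t x) (θ' t x)) -
                  ∫ x, χ x * totalEnergyDensity (ρ t x) (u t x) (θ t x)| ≤ δ := by
  sorry

/-! ## The stub STATEMENTS under the stubs' own registered names (hypotheses of
`SmallKappaAccuracy_of`; D-0027 §3.3 shape: `Statement.stub_x := type_of% stub_x`) -/

namespace Statement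

/-- Statement of S1 `stub_landauTellerWindow`. -/
abbrev stub_landauTellerWindow : Prop := type_of% Birth.stub_landauTellerWindow
/-- Statement of S2 `stub_relaxationContinuity`. -/
abbrev stub_relaxationContinuity : Prop := type_of% Birth.stub_relaxationContinuity

end Statement

/-! ## Three elementary lemmas of the composition (sorry-free) -/

/-- `f_N → 0` in `ℝ≥0∞` gives `f_N ≤ ofReal η` eventually, for `η > 0`. -/
theorem tendsto_zero_eventually_le {f : ℕ → ℝ≥0∞} (h : Tendsto f atTop (𝓝 0)) {η : ℝ}
    (hη : 0 < η) : ∀ᶠ N in atTop, f N ≤ ENNReal.ofReal η :=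
  (ENNReal.tendsto_nhds_zero.1 h) _ (ENNReal.ofReal_pos.2 hη)

/-- Triangle inequality on deviation events (scalar): if `|I' − I| ≤ δ/2` then
`{δ < |D − I|} ⊆ {δ/2 < |D − I'|}`. -/
theorem measure_mono_abs_dev {α : Type*} [MeasurableSpace α] (μ : Measure α) {D : α → ℝ}
    {I I' δ : ℝ} (h : |I' - I| ≤ δ / 2) :
    μ {p | δ < |D p - I|} ≤ μ {p | δ / 2 < |D p - I'|} := by
  refine measure_mono fun p hp => ?_
  simp only [Set.mem_setOf_eq] at hp ⊢
  have h1 := abs_sub_abs_le_abs_sub (D p - I) (D p - I')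
  rw [sub_sub_sub_cancel_left] at h1
  linarith

/-- Triangle inequality on deviation events (vector): if `‖I' − I‖ ≤ δ/2` then
`{δ < ‖D − I‖} ⊆ {δ/2 < ‖D − I'‖}`. -/
theorem measure_mono_norm_dev {α E : Type*} [MeasurableSpace α] [SeminormedAddCommGroup E]
    (μ : Measure α) {D : α → E} {I I' : E} {δ : ℝ} (h : ‖I' - I‖ ≤ δ / 2) :
    μ {p | δ < ‖D p - I‖} ≤ μ {p | δ / 2 < ‖D p - I'‖} := by
  refine measure_mono fun p hp => ?_
  simp only [Set.mem_setOf_eq] at hp ⊢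
  have h1 := norm_sub_norm_le (D p - I) (D p - I')
  rw [sub_sub_sub_cancel_left] at h1
  linarith

/-! ## Composition (sorry-free): the two stubs ⟹ the crux BY NAME -/

/-- **The skeleton theorem.** `η₀ := min η₁ η₂`, `σ₀ :=` the window's. Given the conjunct's guarded
hs-Euler solution, the `t = 0` hypothesis, `t < T`, `χ`, `δ`, `η`: S2 at `δ/2` gives `r₀`; for
`r < min r₀ r₁` it hands an Euler–Landau–Teller solution through the same well-prepared data, in the
band, `δ/2`-close in the three tested integrals at time `t`; S1 at `δ/2` (the `t = 0` hypothesis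
transported along the equal data) gives the three convergences in probability towards that
solution's fields; `N₀` from `ENNReal.tendsto_nhds_zero`; each clause by the triangle inequality and
`measure_mono`. The crux's inline `let` telescope is rewritten into `roughFlow / roughInit /
spinLaw` by the `RoughSphereFlowInline` bridge first. -/
theorem SmallKappaAccuracy_of (h1 : Statement.stub_landauTellerWindow)
    (h2 : Statement.stub_relaxationContinuity) :
    Summit.AtomisticToContinuum.HydrodynamicLimit.Theses.BryanRoughSphereDial.SmallKappaAccuracy := by
  obtain ⟨η₁, hη₁, r₁, hr₁, c, hc, HW⟩ := (h1 : type_of% Birth.stub_landauTellerWindow)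
  obtain ⟨η₂, hη₂, HC⟩ := (h2 : type_of% Birth.stub_relaxationContinuity)
  refine ⟨min η₁ η₂, lt_min hη₁ hη₂, ?_⟩
  -- library names for the inline rough-sphere objects, then β/ζ-normalise the frame
  rw [roughFlow_inline, roughInit_inline, spinLaw_inline]
  dsimp only
  intro a₀ θ₀ u₀ ha hθ hu hap hθp
  obtain ⟨σ₀, hσ₀, HWσ⟩ := HW a₀ θ₀ u₀ ha hθ hu hap hθp
  refine ⟨σ₀, hσ₀, ?_⟩
  intro σ hσ hσlt T ρ θ u hsol hguard Φ h0 t ht χ hχ δ hδ η hη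
  obtain ⟨r₀, hr₀, HCr⟩ := HC c hc σ hσ (min η₁ η₂) (lt_min hη₁ hη₂) (min_le_right _ _)
    T ρ θ u hsol hguard t ht χ hχ (δ / 2) (half_pos hδ)
  refine ⟨min r₀ r₁, lt_min hr₀ hr₁, ?_⟩
  intro r hr hrlt
  obtain ⟨T', ρ', θ', θr', u', htT', hLT, hguard', hρ0, hu0, hθ0, hθr0, hc1, hc2, hc3⟩ :=
    HCr r hr (lt_of_lt_of_le hrlt (min_le_left _ _))
  have h0' : TendstoHydroFieldsAt (fun N => localGibbsLaw σ a₀ u₀ θ₀ N (Φ N)) Φ ρ' u' θ' 0 := by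
    intro χ' hχ' δ' hδ'
    simpa only [hρ0, hu0, hθ0] using h0 χ' hχ' δ' hδ'
  have hband : ∀ s ∈ Set.Ico 0 T', ∀ x, ρ' s x * σ ^ 3 < η₁ := fun s hs x =>
    lt_of_lt_of_le (hguard' s hs x) (min_le_left _ _)
  have hwp : ∀ x, θr' 0 x = θ' 0 x := fun x => (hθr0 x).trans (hθ0 x).symm
  obtain ⟨E1, E2, E3⟩ := HWσ σ hσ hσlt r hr (lt_of_lt_of_le hrlt (min_le_right _ _))
    T' ρ' θ' θr' u' hLT hband hwp Φ h0' t ⟨ht.1, htT'⟩ χ hχ (δ / 2) (half_pos hδ)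
  obtain ⟨N₀, hN₀⟩ := Filter.eventually_atTop.1
    (((tendsto_zero_eventually_le E1 hη).and (tendsto_zero_eventually_le E2 hη)).and
      (tendsto_zero_eventually_le E3 hη))
  refine ⟨N₀, fun N hN => ?_⟩
  obtain ⟨⟨e1, e2⟩, e3⟩ := hN₀ N hN
  exact ⟨(measure_mono_abs_dev _ hc1).trans e1, (measure_mono_norm_dev _ hc2).trans e2,
    (measure_mono_abs_dev _ hc3).trans e3⟩

end Summit.AtomisticToContinuum.HydrodynamicLimit.Cruxes.SmallKappaAccuracy.Birth

end
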